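import Summits.QuantumFields.YangMills.Theorems.FluctuationComparisonRegPrIntLOrganTangentFibreMeanVersionMW
import Summits.QuantumFields.YangMills.Theorems.FluctuationComparisonRegPrIntLOrganTangentAPackageDescendTo
import Summits.QuantumFields.YangMills.Theorems.FluctuationComparisonRegPrIntLOrganTangentChartVarianceRepresentationSelf
import Summits.QuantumFields.YangMills.Theorems.FluctuationComparisonRegPrIntLOrganTangentTangentHOfSpreadFibreLaw
import Summits.QuantumFields.YangMills.Theorems.FluctuationComparisonRegPrIntLOrganTangentMultiWindowWeight
import Summits.QuantumFields.YangMills.Theorems.FluctuationComparisonRegPrIntLOrganTangentFibreVarianceRebracket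
import Summits.QuantumFields.YangMills.Theorems.FluctuationComparisonRegPrIntLRunpairOrganFibreLawJDefs
import Literature.MathematicalPhysics.QuantumFieldTheory.Balaban1983to89.BalabanAdmissibleClassParams
import Literature.MathematicalPhysics.QuantumFieldTheory.Balaban1983to89.T4AveragingDisintegration
import Literature.MathematicalPhysics.QuantumFieldTheory.Balaban1983to89.T4CubeChartExp
import HarnessLib

/-!
# Route `UnitScaleTilt` — crux `FluctuationComparisonRegPrIntL` (stmt-QuantumFields-20520, rung R3), PATH-B organ — THE JENSEN KNIT, THEOREMS-SIDE:
# `jvarH_of_spreadFibreLawHJ : SpreadFibreLawHJ → ⟨JVARᵘ-H″⟩` (★★OWNER RULINGS №72 «TN-KNIT-LANDING» (a) ∕ №73, applied to the Jensen edition)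

Cell `ym3-torus` (YM ladder rung R3 = continuum `SU(2)` Yang–Mills on the three-torus — a RUNG: NOT d = 4, NOT infinite volume, NOT a mass gap, NOT Clay).  LEAD-20520 width seat
`ym-ust-20520-w3` g26: knit = crux workfile `Cruxes/FluctuationComparisonRegPrIntL/JvarKnit_LEAD_w3g26.lean` v0.1 (commit 667132b7ca17, sorry-free), landed VERBATIM on the reviewed
definitions file `FluctuationComparisonRegPrIntLRunpairOrganFibreLawJDefs` (`SpreadFibreLawHJ`, frozen Jensen edition v0.2, body ws16 3bd44078399401c2; design of its (HV′) block:
width seats `ym3-torus-px5` g19∕g20 (cumulant form, t-uniform letters) + LEAD №33 R3 (law normalisation); pen ideator `ym-r3-idea-1` g28): the proof block is the workfile's modulo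
(i) the inlined `FibreLawHJ` namespace replaced by the import, (ii) the private VARIANCE REBRACKET replaced by px5 g20's reviewed ✓`…OrganTangentFibreVarianceRebracket.abs_fibreVar_secondDiff_le_means`
(same statement, binder for binder), (iii) the conclusion SPELLED OUT (the workfile's `def JvarUH2` unfolded: JVARᵘ-H″ ws16 cd60cefdb3ed06bb = ✓p812220
`…JensenHOfJvarHV22.jensenH_of_jvarH`'s `hJV` binder, so `jensenH_of_jvarH (jvarH_of_spreadFibreLawHJ hF)` type-checks by `exact`).

THE KNIT: (0) heads ∕ package — `γ₁ := min γF 1`, `θ := 1`, `r := rc∕2`, `C := 4·NV1 + 2·NV2 + 3·NV3 + NV4`, `δ := 4δV1 + 2δV2 + 3δV3 + δV4`, `j₁ := max j₁ jA`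
(`jA` = ✓`exists_height_multiWindowWeight`); (1) per stride `(j, Ts)`: the row's fibred chart `(Z, τ, Φ, J, S, π)` and its (HV′) block fed with JVAR's own seed square clause `(k, w)`
by `exact` — NOTHING of the (H) block is used; (2) THE TILTED FIBRE VARIANCE IS THE CHART RATIO on the window: JVAR's `∀ σ₀ lam` (A)-package frame is identified with
`X ↦ ∫ (h_Ts(Φ(X,z)) − ∫ h_Ts(Φ(X,·))·wgt_t(X,·))²·wgt_t(X,z) dτ` by w5 g23's ✓`tiltedVariance_eq_chartRatio_on_window_self` (`…ChartVarianceRepresentationSelf`, over ✓(WD)∕(TV)∕(JV))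
and the `wgt` spelling `ratio_eq_wgtForm`; (3) per coarse one-bond square `U V W Y`: ✓`abs_fibreVar_secondDiff_le_means` — `fourCorner_rebracket` over the nine own-law-centred
variances `𝒱(a,c)`, transport group ← (JV1-h) ×4 + 2·(JV2-h) (the mean part dies by (JV0-h)'s `∫ ŵ = 1`), mixed groups ← (JV3-h′) direct and TRANSPOSED through
✓`…OrganTangentTangentHOfSpreadFibreLaw.fourthCorner_lawEdge` (conjugate one-bond move of size `≤ √3·‖v‖` — factor 2 on `kV₃ᵀ`, `r = rc∕2`), law group ← (JV4-h′);
(4) witnesses `w′ := (4NV1 + 2NV2 + 3NV3 + NV4)·Dr·w·(w∕D_Ts) + (4δV1 + 2δV2 + 3δV3 + δV4) j·D_j`, `k′ := 4kV₁ + 2kV₂ + kV₃ + 2kV₃ᵀ + kV₄`, row mass via the column mass of `kV₃`,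
budget `1·(w′∕D_j) = C·x·x + δ j`.

HONEST FRAMING: bookkeeping over HYPOTHESIS schemas — an implication between the hypothesis row `SpreadFibreLawHJ` (XL, not printed as a theorem; shapes after [Balaban1987RG1]
Thm 1 ∕ Thm 3 ∕ (0.22)–(0.30), [Balaban1985Variational] Thm 1 ∕ Prop 9, [Balaban1985Averaging] (10)–(13)) and the hypothesis text JVARᵘ-H″; nothing of Bałaban's analysis is
asserted or proved; `SpreadFibreLawHJ`, JVAR″ (as O1's input), JEN″, LIN″, O1ᵘ-H v2.2, S1aᴴ, S3ᴴ, S2α′, S2β, 26243 OPEN; crux 20520 `FluctuationComparisonRegPrIntL`, the five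
registered stubs of `Lines/semiclassical_s2beta.lean` and `YM3TorusSU2` are NOT proved; registry untouched; rung R3 = SU(2) YM₃ on T³ at fixed lattice data — NOT d = 4, NOT
infinite volume, NOT a mass gap, NOT Clay; the Yang–Mills mass gap is NOT proved.
-/

set_option autoImplicit false

noncomputable section

namespace Summit.QuantumFields.YangMills.Theorems.OrganTangentJvarHOfSpreadFibreLawJ

open MeasureTheory Filter Topology Function
open scoped ENNReal NNReal BigOperators
open Literature.MathematicalPhysics.QuantumFieldTheory.Balaban1983to89 T3ContinuumYM3Torus T3NestedUnitLaws
  T3UnitLawDensityEML T4Continuum BalabanUVClass T3UnitScaleTilt T3LevelShift T3TiltDescent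
open T4CubeChartExp (expPt)
open Summit.QuantumFields.YangMills.Theorems.FluctuationComparisonRegPrIntLOrganTangentFibreMeanVersionMW
open Summit.QuantumFields.YangMills.Theorems.FluctuationComparisonRegPrIntLOrganTangentAPackageDescendTo
open Summit.QuantumFields.YangMills.Theorems.FluctuationComparisonRegPrIntLRunpairOrganFibreLaw (mwCut wNum wgt)
open Summit.QuantumFields.YangMills.Theorems.FluctuationComparisonRegPrIntLRunpairOrganFibreLawJ
open Summit.QuantumFields.YangMills.Theorems.FluctuationComparisonRegPrIntLOrganTangentMultiWindowWeight (exists_height_multiWindowWeight)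
open Summit.QuantumFields.YangMills.Theorems.OrganTangentTangentHOfSpreadFibreLaw (fourthCorner_lawEdge)

/-- kernel: the ℓ¹ torus step distance is symmetric. [folklore] -/
private theorem tdist_comm' {P : Params} {i : ℕ} (x y : Site P i) : Site.tdist x y = Site.tdist y x := by
  unfold Site.tdist
  exact Finset.sum_congr rfl fun μ _ => min_comm _ _

/-- kernel: the tilted-variance chart RATIO in `wgt` form — `(∫ (f − (∫ f w)∕(∫ w))²·w)∕(∫ w) = ∫ (f − ∫ f·ŵ)²·ŵ` with `ŵ := w ∕ ∫ w`. [folklore] -/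
private theorem ratio_eq_wgtForm {Z : Type*} [MeasurableSpace Z] (τ : Measure Z) (f w : Z → ℝ) :
    (∫ z, (f z - (∫ z', f z' * w z' ∂τ) / (∫ z', w z' ∂τ)) ^ 2 * w z ∂τ) / (∫ z', w z' ∂τ)
      = ∫ z, (f z - ∫ z', f z' * (w z' / ∫ z'', w z'' ∂τ) ∂τ) ^ 2 * (w z / ∫ z', w z' ∂τ) ∂τ := by
  have hc : (∫ z', f z' * w z' ∂τ) / (∫ z', w z' ∂τ) = ∫ z', f z' * (w z' / ∫ z'', w z'' ∂τ) ∂τ := by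
    rw [← integral_div]
    exact integral_congr_ae (Filter.Eventually.of_forall fun z => (mul_div_assoc _ _ _))
  rw [← integral_div, hc]
  exact integral_congr_ae (Filter.Eventually.of_forall fun z => (mul_div_assoc _ _ _))

/-- ★★★ **THE JENSEN KNIT**: `SpreadFibreLawHJ → JVARᵘ-H″` — the conclusion is the hypothesis text JVARᵘ-H″ (ws16 cd60cefdb3ed06bb = ✓p812220's `hJV` binder) SPELLED OUT.
Bookkeeping over hypothesis schemas (module docstring: steps (0)–(4)); nothing of Bałaban's is asserted. [folklore] -/
theorem jvarH_of_spreadFibreLawHJ (hF : SpreadFibreLawHJ) :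
  ∃ pW : ℝ, ∃ γ₁ : ℝ, 0 < γ₁ ∧ ∀ (F : T3Family) (γ : ℝ), 0 < γ → γ ≤ γ₁ → ∀ (b₀ p₀ : ℝ) (j₀ : ℕ) (prm : ℕ → ClassParams) (η : ℕ → ℝ) (rA : ℝ) (Bρ : ℕ → ℝ), 0 < b₀ → 0 < p₀ → pW ≤ p₀ → AdmissibleClassParams F γ b₀ p₀ prm → (∀ j, 0 ≤ η j) → Summable η → Summable (fun i => ∑' k, η (k + i)) → Tendsto (fun j => (∑' k, η (k + j)) * ((1 + 2 * ((F.L : ℝ) ^ j / γ) * (Fintype.card (Plaq (F.P j) 0) : ℝ)) * (Fintype.card (PBond (F.P j) 0) : ℝ) ^ 2)) atTop (𝓝 0) → 0 < rA → ∃ κ₀ : ℝ, 0 < κ₀ ∧ ∀ (κ : ℝ), 0 < κ → κ ≤ κ₀ → ∃ (θ r C w₀ : ℝ) (δ : ℕ → ℝ) (j₁ : ℕ), 0 < θ ∧ 0 < r ∧ 0 ≤ C ∧ 0 < w₀ ∧ (∀ j, 0 ≤ δ j) ∧ Summable δ ∧ Summable (fun i => ∑' k, δ (k + i)) ∧ Tendsto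 (fun j => (∑' k, δ (k + j)) * ((1 + 2 * ((F.L : ℝ) ^ j / γ) * (Fintype.card (Plaq (F.P j) 0) : ℝ)) * (Fintype.card (PBond (F.P j) 0) : ℝ) ^ 2)) atTop (𝓝 0) ∧ j₀ ≤ j₁ ∧ ∀ (ν : ℕ → (j : ℕ) → MeasureTheory.Measure (GaugeField (F.P j) 0 ↥(Matrix.specialUnitaryGroup (Fin 2) ℂ))), (∀ K, ν K K = T4GenFunBounds.gibbsMeasure (F.P K) ((F.scheme ℰp γ).β K)) → (∀ K j, j < K → ν K j = Measure.map (descend F ℰp j) (ν K (j + 1))) → ∀ (K K' : ℕ), K ≤ K' → ∀ (Ts T : ℕ), Ts < T → T ≤ K → ∀ (μ μ' : ((j : ℕ) → MeasureTheory.Measure (GaugeField (F.P j) 0 ↥(Matrix.specialUnitaryGroup (Fin 2) ℂ)))) (ρ ρ' : ((j : ℕ) → GaugeField (F.P j) 0 ↥(Matrix.specialUnitaryGroup (Fin 2) ℂ) → ℝ)), (∀ j : ℕ, Ts ≤ j → j ≤ T → μ j = ν K j ∧ μ' j = ν K' j) → (∀ j : ℕ, j < Ts → μ j = Measure.map (descend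 F ℰp j) ((μ (j + 1)).withDensity (fun U => ENNReal.ofReal ((∏ p : Plaq _ _, max 0 (min 1 ((24 / 25 * (θBal F.L γ b₀ p₀ (j + 1)) - dist1 (GaugeField.plaqHol U p)) / ((24 / 25 - 1 / 2) * (θBal F.L γ b₀ p₀ (j + 1))))))))) ∧ μ' j = Measure.map (descend F ℰp j) ((μ' (j + 1)).withDensity (fun U => ENNReal.ofReal ((∏ p : Plaq _ _, max 0 (min 1 ((24 / 25 * (θBal F.L γ b₀ p₀ (j + 1)) - dist1 (GaugeField.plaqHol U p)) / ((24 / 25 - 1 / 2) * (θBal F.L γ b₀ p₀ (j + 1)))))))))) → (∀ j : ℕ, Ts ≤ j → j < T → μ j = Measure.map (descend F ℰp j) (μ (j + 1)) ∧ μ' j = Measure.map (descend F ℰp j) (μ' (j + 1))) → (∀ j : ℕ, j ≤ T → IsFiniteMeasure (μ j) ∧ IsFiniteMeasure (μ' j)) → (∀ j : ℕ, j₀ ≤ j → j ≤ T → ((∀ U, PlaqSmall (θBal F.L γ b₀ p₀ j) U → 0 < ρ j U ∧ 0 < ρ' j U) ∧ μ j = (fieldMeasure _ _ _).withDensity (fun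 U => ENNReal.ofReal (ρ j U)) ∧ μ' j = (fieldMeasure _ _ _).withDensity (fun U => ENNReal.ofReal (ρ' j U)) ∧ (∃ κ : ℝ, MemAtHeight F ℰp j (prm j) (fun U => Real.exp κ * ρ j U)) ∧ (∃ κ : ℝ, MemAtHeight F ℰp j (prm j) (fun U => Real.exp κ * ρ' j U)) ∧ μ j {U | ¬ PlaqSmall (θBal F.L γ b₀ p₀ j) U} ≤ ENNReal.ofReal (η j) ∧ μ' j {U | ¬ PlaqSmall (θBal F.L γ b₀ p₀ j) U} ≤ ENNReal.ofReal (η j) ∧ (ContinuousOn (ρ j) {U | PlaqSmall (θBal F.L γ b₀ p₀ j) U} ∧ ContinuousOn (ρ' j) {U | PlaqSmall (θBal F.L γ b₀ p₀ j) U}) ∧ ((∀ (U : GaugeField _ _ ↥(Matrix.specialUnitaryGroup (Fin 2) ℂ)), PlaqSmall (49 / 50 * θBal F.L γ b₀ p₀ j) U → ∀ (b b' : PBond _ _) (v v' : Fin 3 → ℝ), ‖v‖ ≤ 1 → ‖v'‖ ≤ 1 → ∃ g : ℂ × ℂ → ℂ, DifferentiableOn ℂ g (Metric.ball (0 : ℂ)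 (rA * (49 / 50 * θBal F.L γ b₀ p₀ j)) ×ˢ Metric.ball (0 : ℂ) (rA * (49 / 50 * θBal F.L γ b₀ p₀ j))) ∧ (∀ (s t : ℝ) (V Z : GaugeField _ _ ↥(Matrix.specialUnitaryGroup (Fin 2) ℂ)), |s| < rA * (49 / 50 * θBal F.L γ b₀ p₀ j) → |t| < rA * (49 / 50 * θBal F.L γ b₀ p₀ j) → (∀ e, e ≠ b → V e = U e) → V b = U b * expPt (s • v) → (∀ e, e ≠ b' → Z e = V e) → Z b' = V b' * expPt (t • v') → g ((s : ℂ), (t : ℂ)) = (((Real.log (ρ j Z)) : ℝ) : ℂ)) ∧ ∀ z ∈ Metric.ball (0 : ℂ) (rA * (49 / 50 * θBal F.L γ b₀ p₀ j)) ×ˢ Metric.ball (0 : ℂ) (rA * (49 / 50 * θBal F.L γ b₀ p₀ j)), ‖g z - g 0‖ ≤ (Bρ j)) ∧ (∀ (U : GaugeField _ _ ↥(Matrix.specialUnitaryGroup (Fin 2) ℂ)), PlaqSmall (49 / 50 * θBal F.L γ b₀ p₀ j) U → ∀ (b b' : PBond _ _) (v v' : Fin 3 → ℝ), ‖v‖ ≤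 1 → ‖v'‖ ≤ 1 → ∃ g : ℂ × ℂ → ℂ, DifferentiableOn ℂ g (Metric.ball (0 : ℂ) (rA * (49 / 50 * θBal F.L γ b₀ p₀ j)) ×ˢ Metric.ball (0 : ℂ) (rA * (49 / 50 * θBal F.L γ b₀ p₀ j))) ∧ (∀ (s t : ℝ) (V Z : GaugeField _ _ ↥(Matrix.specialUnitaryGroup (Fin 2) ℂ)), |s| < rA * (49 / 50 * θBal F.L γ b₀ p₀ j) → |t| < rA * (49 / 50 * θBal F.L γ b₀ p₀ j) → (∀ e, e ≠ b → V e = U e) → V b = U b * expPt (s • v) → (∀ e, e ≠ b' → Z e = V e) → Z b' = V b' * expPt (t • v') → g ((s : ℂ), (t : ℂ)) = (((Real.log (ρ' j Z)) : ℝ) : ℂ)) ∧ ∀ z ∈ Metric.ball (0 : ℂ) (rA * (49 / 50 * θBal F.L γ b₀ p₀ j)) ×ˢ Metric.ball (0 : ℂ) (rA * (49 / 50 * θBal F.L γ b₀ p₀ j)), ‖g z - g 0‖ ≤ (Bρ j))))) → ∀ (w : ℝ), 0 ≤ w → w / (((F.L : ℝ) ^ Ts / γ) * θBal F.L γ b₀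 p₀ Ts ^ 2) ≤ w₀ → (∃ k : PBond (F.P Ts) 0 → PBond (F.P Ts) 0 → ℝ, (∀ b b', 0 ≤ k b b') ∧ (∀ b, ∑ b', k b b' * Real.exp (κ * (b.src.tdist b'.src : ℝ)) ≤ w) ∧ (∀ (b b' : PBond _ _) (v v' : Fin 3 → ℝ) (U V W Z : GaugeField _ _ ↥(Matrix.specialUnitaryGroup (Fin 2) ℂ)), ‖v‖ ≤ (rA / 2) * (θBal F.L γ b₀ p₀ Ts / 4) → ‖v'‖ ≤ (rA / 2) * (θBal F.L γ b₀ p₀ Ts / 4) → PlaqSmall (θBal F.L γ b₀ p₀ Ts / 4) U → PlaqSmall (θBal F.L γ b₀ p₀ Ts / 4) V → PlaqSmall (θBal F.L γ b₀ p₀ Ts / 4) W → PlaqSmall (θBal F.L γ b₀ p₀ Ts / 4) Z → (∀ e, e ≠ b → V e = U e) → V b = U b * expPt v → (∀ e, e ≠ b' → W e = U e) → W b' = U b' * expPt v' → (∀ e, e ≠ b' → Z e = V e) → Z b' = V b' * expPt v' → |(Real.log (ρ Ts Z) - Real.log (ρ' Ts Z)) - (Real.log (ρ Ts V) - Real.log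 (ρ' Ts V)) - (Real.log (ρ Ts W) - Real.log (ρ' Ts W)) + (Real.log (ρ Ts U) - Real.log (ρ' Ts U))| ≤ k b b' * (‖v‖ / (θBal F.L γ b₀ p₀ Ts / 4)) * (‖v'‖ / (θBal F.L γ b₀ p₀ Ts / 4)))) → ∀ (j : ℕ), j₁ ≤ j → ∀ (hjTs : j + 1 ≤ Ts), ∀ (σ : ProbabilityTheory.Kernel (GaugeField (F.P j) 0 ↥(Matrix.specialUnitaryGroup (Fin 2) ℂ)) (GaugeField (F.P Ts) 0 ↥(Matrix.specialUnitaryGroup (Fin 2) ℂ))), ProbabilityTheory.IsMarkovKernel σ → (Measure.map (descendTo F ℰp j Ts (Nat.le_of_succ_le hjTs)) (fieldMeasure (F.P Ts) 0 ↥(Matrix.specialUnitaryGroup (Fin 2) ℂ))).bind ⇑σ = fieldMeasure (F.P Ts) 0 ↥(Matrix.specialUnitaryGroup (Fin 2) ℂ) → (∀ᵐ V ∂(Measure.map (descendTo F ℰp j Ts (Nat.le_of_succ_le hjTs)) (fieldMeasure (F.P Ts) 0 ↥(Matrix.specialUnitaryGroup (Fin 2) ℂ))), ∀ᵐ U ∂(σ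 V), descendTo F ℰp j Ts (Nat.le_of_succ_le hjTs) U = V) → ∀ (mfun : GaugeField (F.P j) 0 ↥(Matrix.specialUnitaryGroup (Fin 2) ℂ) → ℝ), ContinuousOn mfun {V | PlaqSmall (θBal F.L γ b₀ p₀ j) V} → (∀ᵐ V ∂(fieldMeasure (F.P j) 0 ↥(Matrix.specialUnitaryGroup (Fin 2) ℂ)), PlaqSmall (θBal F.L γ b₀ p₀ j) V → MeasureTheory.Integrable (fun U => (∏ i ∈ Finset.range (Ts - j), (if h : j + 1 + i ≤ Ts then (∏ p : Plaq (F.P (j + 1 + i)) 0, max 0 (min 1 ((24 / 25 * θBal F.L γ b₀ p₀ (j + 1 + i) - dist1 (GaugeField.plaqHol (descendTo F ℰp (j + 1 + i) Ts h U) p)) / ((24 / 25 - 1 / 2) * θBal F.L γ b₀ p₀ (j + 1 + i))))) else 1)) * (Real.log (ρ Ts U) - Real.log (ρ' Ts U)) * ρ' Ts U) (σ V) ∧ mfun V = (∫ U, (∏ i ∈ Finset.range (Ts - j), (if h : j + 1 + i ≤ Ts then (∏ p : Plaq (F.P (j + 1 + i)) 0, max 0 (min 1 ((24 / 25 * θBal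 F.L γ b₀ p₀ (j + 1 + i) - dist1 (GaugeField.plaqHol (descendTo F ℰp (j + 1 + i) Ts h U) p)) / ((24 / 25 - 1 / 2) * θBal F.L γ b₀ p₀ (j + 1 + i))))) else 1)) * (Real.log (ρ Ts U) - Real.log (ρ' Ts U)) * ρ' Ts U ∂(σ V)) / (∫ U, (∏ i ∈ Finset.range (Ts - j), (if h : j + 1 + i ≤ Ts then (∏ p : Plaq (F.P (j + 1 + i)) 0, max 0 (min 1 ((24 / 25 * θBal F.L γ b₀ p₀ (j + 1 + i) - dist1 (GaugeField.plaqHol (descendTo F ℰp (j + 1 + i) Ts h U) p)) / ((24 / 25 - 1 / 2) * θBal F.L γ b₀ p₀ (j + 1 + i))))) else 1)) * ρ' Ts U ∂(σ V))) → ∀ (σ₀ : ProbabilityTheory.Kernel (GaugeField (F.P j) 0 ↥(Matrix.specialUnitaryGroup (Fin 2) ℂ)) (GaugeField (F.P Ts) 0 ↥(Matrix.specialUnitaryGroup (Fin 2) ℂ))) (lam : GaugeField (F.P j) 0 ↥(Matrix.specialUnitaryGroup (Fin 2) ℂ) → MeasureTheory.Measure (GaugeField (F.P Ts) 0 ↥(Matrix.specialUnitaryGroup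 (Fin 2) ℂ))), ProbabilityTheory.IsMarkovKernel σ₀ → (Measure.map (descendTo F ℰp j Ts (Nat.le_of_succ_le hjTs)) (fieldMeasure (F.P Ts) 0 ↥(Matrix.specialUnitaryGroup (Fin 2) ℂ))).bind ⇑σ₀ = fieldMeasure (F.P Ts) 0 ↥(Matrix.specialUnitaryGroup (Fin 2) ℂ) → (∀ᵐ V ∂(Measure.map (descendTo F ℰp j Ts (Nat.le_of_succ_le hjTs)) (fieldMeasure (F.P Ts) 0 ↥(Matrix.specialUnitaryGroup (Fin 2) ℂ))), ∀ᵐ U ∂(σ₀ V), descendTo F ℰp j Ts (Nat.le_of_succ_le hjTs) U = V) → (∀ V, MeasureTheory.IsFiniteMeasure (lam V)) → (∀ f : GaugeField (F.P Ts) 0 ↥(Matrix.specialUnitaryGroup (Fin 2) ℂ) → ℝ, Continuous f → (∀ U, f U ≠ 0 → ∀ (n : ℕ) (hjn : j + 1 ≤ n) (hnK : n ≤ Ts), PlaqSmall (24 / 25 * θBal F.L γ b₀ p₀ n) (descendTo F ℰp n Ts hnK U)) → ContinuousOn (fun V => ∫ U, f U ∂(lam V)) {V | PlaqSmall (θBal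 F.L γ b₀ p₀ j) V}) → (∀ V, PlaqSmall (θBal F.L γ b₀ p₀ j) V → 0 < lam V {U | ∀ (n : ℕ) (hjn : j + 1 ≤ n) (hnK : n ≤ Ts), PlaqSmall (24 / 25 * θBal F.L γ b₀ p₀ n) (descendTo F ℰp n Ts hnK U)}) → (∃ c : GaugeField (F.P j) 0 ↥(Matrix.specialUnitaryGroup (Fin 2) ℂ) → ℝ, ∀ f : GaugeField (F.P Ts) 0 ↥(Matrix.specialUnitaryGroup (Fin 2) ℂ) → ℝ, Continuous f → (∀ U, ¬ (∀ (n : ℕ) (hjn : j + 1 ≤ n) (hnK : n ≤ Ts), PlaqSmall (24 / 25 * θBal F.L γ b₀ p₀ n) (descendTo F ℰp n Ts hnK U)) → f U = 0) → ∀ᵐ V ∂(Measure.map (descendTo F ℰp j Ts (Nat.le_of_succ_le hjTs)) (fieldMeasure (F.P Ts) 0 ↥(Matrix.specialUnitaryGroup (Fin 2) ℂ))), PlaqSmall (θBal F.L γ b₀ p₀ j) V → 0 < c V ∧ ∫ U, f U ∂(σ₀ V) = c V * ∫ U, f U ∂(lam V)) → ∃ w' : ℝ, 0 ≤ w' ∧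 θ * (w' / (((F.L : ℝ) ^ j / γ) * θBal F.L γ b₀ p₀ j ^ 2)) ≤ C * (w / (((F.L : ℝ) ^ Ts / γ) * θBal F.L γ b₀ p₀ Ts ^ 2)) * (w / (((F.L : ℝ) ^ Ts / γ) * θBal F.L γ b₀ p₀ Ts ^ 2)) + δ j ∧ ∃ k' : PBond (F.P j) 0 → PBond (F.P j) 0 → ℝ, (∀ b b', 0 ≤ k' b b') ∧ (∀ b, ∑ b', k' b b' * Real.exp (κ * (b.src.tdist b'.src : ℝ)) ≤ w') ∧ ∀ t ∈ Set.Icc (0 : ℝ) 1, (∀ (b b' : PBond _ _) (v v' : Fin 3 → ℝ) (U V W Z : GaugeField _ _ ↥(Matrix.specialUnitaryGroup (Fin 2) ℂ)), ‖v‖ ≤ r * (θBal F.L γ b₀ p₀ j / 4) → ‖v'‖ ≤ r * (θBal F.L γ b₀ p₀ j / 4) → PlaqSmall (θBal F.L γ b₀ p₀ j / 4) U → PlaqSmall (θBal F.L γ b₀ p₀ j / 4) V → PlaqSmall (θBal F.L γ b₀ p₀ j / 4) W → PlaqSmall (θBal F.L γ b₀ p₀ j / 4) Z → (∀ e, e ≠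 b → V e = U e) → V b = U b * expPt v → (∀ e, e ≠ b' → W e = U e) → W b' = U b' * expPt v' → (∀ e, e ≠ b' → Z e = V e) → Z b' = V b' * expPt v' → |ProbabilityTheory.variance (fun U => Real.log (ρ Ts U) - Real.log (ρ' Ts U)) (((lam Z).withDensity (fun U => ENNReal.ofReal ((∏ i ∈ Finset.range (Ts - j), (if h : j + 1 + i ≤ Ts then (∏ p : Plaq (F.P (j + 1 + i)) 0, max 0 (min 1 ((24 / 25 * θBal F.L γ b₀ p₀ (j + 1 + i) - dist1 (GaugeField.plaqHol (descendTo F ℰp (j + 1 + i) Ts h U) p)) / ((24 / 25 - 1 / 2) * θBal F.L γ b₀ p₀ (j + 1 + i))))) else 1)) * ρ' Ts U))).tilted (fun U => t * (Real.log (ρ Ts U) - Real.log (ρ' Ts U)))) - ProbabilityTheory.variance (fun U => Real.log (ρ Ts U) - Real.log (ρ' Ts U)) (((lam V).withDensity (fun U => ENNReal.ofReal ((∏ i ∈ Finset.range (Ts - j), (if h : j + 1 + i ≤ Ts then (∏ p : Plaq (F.P (j + 1 + i)) 0, max 0 (min 1 ((24 / 25 * θBal F.L γ b₀ p₀ (j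 + 1 + i) - dist1 (GaugeField.plaqHol (descendTo F ℰp (j + 1 + i) Ts h U) p)) / ((24 / 25 - 1 / 2) * θBal F.L γ b₀ p₀ (j + 1 + i))))) else 1)) * ρ' Ts U))).tilted (fun U => t * (Real.log (ρ Ts U) - Real.log (ρ' Ts U)))) - ProbabilityTheory.variance (fun U => Real.log (ρ Ts U) - Real.log (ρ' Ts U)) (((lam W).withDensity (fun U => ENNReal.ofReal ((∏ i ∈ Finset.range (Ts - j), (if h : j + 1 + i ≤ Ts then (∏ p : Plaq (F.P (j + 1 + i)) 0, max 0 (min 1 ((24 / 25 * θBal F.L γ b₀ p₀ (j + 1 + i) - dist1 (GaugeField.plaqHol (descendTo F ℰp (j + 1 + i) Ts h U) p)) / ((24 / 25 - 1 / 2) * θBal F.L γ b₀ p₀ (j + 1 + i))))) else 1)) * ρ' Ts U))).tilted (fun U => t * (Real.log (ρ Ts U) - Real.log (ρ' Ts U)))) + ProbabilityTheory.variance (fun U => Real.log (ρ Ts U) - Real.log (ρ' Ts U)) (((lam U).withDensity (fun U => ENNReal.ofReal ((∏ i ∈ Finset.range (Ts - j), (if h : j + 1 + i ≤ Ts then (∏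 p : Plaq (F.P (j + 1 + i)) 0, max 0 (min 1 ((24 / 25 * θBal F.L γ b₀ p₀ (j + 1 + i) - dist1 (GaugeField.plaqHol (descendTo F ℰp (j + 1 + i) Ts h U) p)) / ((24 / 25 - 1 / 2) * θBal F.L γ b₀ p₀ (j + 1 + i))))) else 1)) * ρ' Ts U))).tilted (fun U => t * (Real.log (ρ Ts U) - Real.log (ρ' Ts U))))| ≤ k' b b' * (‖v‖ / (θBal F.L γ b₀ p₀ j / 4)) * (‖v'‖ / (θBal F.L γ b₀ p₀ j / 4))) := by
  classical
  obtain ⟨pW, γF, hγF, hF⟩ := hF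
  refine ⟨pW, min γF 1, lt_min hγF one_pos, ?_⟩
  intro F γ hγ hγ1 b₀ p₀ j₀ prm η rA Bρ hb₀ hp₀ hpW hadm hη0 hηs hηss hηt hrA
  have hγone : γ ≤ 1 := hγ1.trans (min_le_right _ _)
  obtain ⟨κ₀, hκ₀, hF⟩ := hF F γ hγ (hγ1.trans (min_le_left _ _)) b₀ p₀ j₀ prm η rA Bρ hb₀ hp₀ hpW hadm hη0 hηs hηss hηt hrA
  refine ⟨κ₀, hκ₀, ?_⟩
  intro κ hκ hκle
  obtain ⟨rc, w₀, NT, NX, NL, CJ, NV1, NV2, NV3, NV4, δT, δX, δL, δV1, δV2, δV3, δV4, j₁, hrc, hw₀, hNT, hNX, hNL, hCJ,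
    hδ0, hδTs, hδTss, hδTt, hδXs, hδXss, hδXt, hδLs, hδLss, hδLt,
    ⟨hNV1, hNV2, hNV3, hNV4, hδV0, ⟨hV1s, hV1ss, hV1t⟩, ⟨hV2s, hV2ss, hV2t⟩, ⟨hV3s, hV3ss, hV3t⟩, ⟨hV4s, hV4ss, hV4t⟩⟩,
    hj₁, hF⟩ := hF κ hκ hκle
  -- the multi-window cut's height (✓exists_height_multiWindowWeight)
  obtain ⟨jA, hMWA⟩ := exists_height_multiWindowWeight F γ b₀ p₀ hγ hγone hb₀
  -- JVAR's package: θ := 1, r := rc/2, C := 4NV1 + 2NV2 + 3NV3 + NV4, w₀ := w₀, δ := 4δV1 + 2δV2 + 3δV3 + δV4, j₁ := max j₁ jA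
  have hS1 : ∀ i, Summable (fun k => δV1 (k + i)) := fun i => (summable_nat_add_iff i).mpr hV1s
  have hS2 : ∀ i, Summable (fun k => δV2 (k + i)) := fun i => (summable_nat_add_iff i).mpr hV2s
  have hS3 : ∀ i, Summable (fun k => δV3 (k + i)) := fun i => (summable_nat_add_iff i).mpr hV3s
  have hS4 : ∀ i, Summable (fun k => δV4 (k + i)) := fun i => (summable_nat_add_iff i).mpr hV4s
  have htsum : ∀ i, (∑' k, (4 * δV1 (k + i) + 2 * δV2 (k + i) + 3 * δV3 (k + i) + δV4 (k + i)))
      = 4 * (∑' k, δV1 (k + i)) + 2 * (∑' k, δV2 (k + i)) + 3 * (∑' k, δV3 (k + i)) + ∑' k, δV4 (k + i) := by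
    intro i
    rw [((((hS1 i).mul_left 4).add ((hS2 i).mul_left 2)).add ((hS3 i).mul_left 3)).tsum_add (hS4 i),
      (((hS1 i).mul_left 4).add ((hS2 i).mul_left 2)).tsum_add ((hS3 i).mul_left 3),
      ((hS1 i).mul_left 4).tsum_add ((hS2 i).mul_left 2), tsum_mul_left, tsum_mul_left, tsum_mul_left]
  refine ⟨1, rc / 2, 4 * NV1 + 2 * NV2 + 3 * NV3 + NV4, w₀, fun n => 4 * δV1 n + 2 * δV2 n + 3 * δV3 n + δV4 n, max j₁ jA,
    one_pos, half_pos hrc, by positivity, hw₀, ?_, (((hV1s.mul_left 4).add (hV2s.mul_left 2)).add (hV3s.mul_left 3)).add hV4s,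
    ?_, ?_, hj₁.trans (le_max_left _ _), ?_⟩
  · intro n
    obtain ⟨a1, a2, a3, a4⟩ := hδV0 n
    positivity
  · have key : (fun i => ∑' k, (4 * δV1 (k + i) + 2 * δV2 (k + i) + 3 * δV3 (k + i) + δV4 (k + i)))
        = fun i => 4 * (∑' k, δV1 (k + i)) + 2 * (∑' k, δV2 (k + i)) + 3 * (∑' k, δV3 (k + i)) + ∑' k, δV4 (k + i) := funext htsum
    rw [key]
    exact (((hV1ss.mul_left 4).add (hV2ss.mul_left 2)).add (hV3ss.mul_left 3)).add hV4ss
  · have key : (fun j => (∑' k, (4 * δV1 (k + j) + 2 * δV2 (k + j) + 3 * δV3 (k + j) + δV4 (k + j))) * ((1 + 2 * ((F.L : ℝ) ^ j / γ)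
          * (Fintype.card (Plaq (F.P j) 0) : ℝ)) * (Fintype.card (PBond (F.P j) 0) : ℝ) ^ 2))
        = fun j => 4 * ((∑' k, δV1 (k + j)) * ((1 + 2 * ((F.L : ℝ) ^ j / γ) * (Fintype.card (Plaq (F.P j) 0) : ℝ))
            * (Fintype.card (PBond (F.P j) 0) : ℝ) ^ 2))
          + 2 * ((∑' k, δV2 (k + j)) * ((1 + 2 * ((F.L : ℝ) ^ j / γ) * (Fintype.card (Plaq (F.P j) 0) : ℝ))
            * (Fintype.card (PBond (F.P j) 0) : ℝ) ^ 2))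
          + 3 * ((∑' k, δV3 (k + j)) * ((1 + 2 * ((F.L : ℝ) ^ j / γ) * (Fintype.card (Plaq (F.P j) 0) : ℝ))
            * (Fintype.card (PBond (F.P j) 0) : ℝ) ^ 2))
          + (∑' k, δV4 (k + j)) * ((1 + 2 * ((F.L : ℝ) ^ j / γ) * (Fintype.card (Plaq (F.P j) 0) : ℝ))
            * (Fintype.card (PBond (F.P j) 0) : ℝ) ^ 2) := by
      funext j; rw [htsum j]; ring
    rw [key]
    simpa using (((hV1t.const_mul 4).add (hV2t.const_mul 2)).add (hV3t.const_mul 3)).add hV4t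
  · intro ν hG hCν K K' hKK' Ts T hTs hTK μ μ' ρ ρ' hanch hcut hcons hfin hwin w hw0 hwle hseed j hj hjTs σ hσM hσb hσf
      mfun hmc hmae σ₀ lam hσ₀M hbind₀ hfib₀ hlam hA1 hA2 hA3
    have hj1 : j₁ ≤ j := (le_max_left _ _).trans hj
    have hjA : jA ≤ j := (le_max_right _ _).trans hj
    -- the stride's chart and clauses
    obtain ⟨Z, instZ, τ, Φ, J, S, π, hτ, hΦm, hJm, hSm, hS, hsec, hdis, hcont, hJle, hpos, hπ1, hπ2, hH, hHV⟩ :=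
      hF ν hG hCν K K' hKK' Ts T hTs hTK μ μ' ρ ρ' hanch hcut hcons hfin hwin j hj1 hjTs
    obtain ⟨k, hk0, hkrow, hksq⟩ := hseed
    obtain ⟨hJV0, ⟨kV₁, hkV₁0, hkV₁row, hJV1⟩, ⟨kV₂, hkV₂0, hkV₂row, hJV2⟩, ⟨kV₃, hkV₃0, hkV₃row, hkV₃col, hJV3⟩,
      ⟨kV₄, hkV₄0, hkV₄row, hJV4⟩⟩ := hHV k w hw0 hwle hk0 hkrow hksq
    -- the units
    have hLpos : (0 : ℝ) < (F.L : ℝ) := by exact_mod_cast (lt_trans zero_lt_one F.hL.2)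
    have hθj : 0 < θBal F.L γ b₀ p₀ j := T3MinimiserStabilityReduction.θBal_pos F.hL.2.le hγ hγone hb₀ p₀ j
    have hθT : 0 < θBal F.L γ b₀ p₀ Ts := T3MinimiserStabilityReduction.θBal_pos F.hL.2.le hγ hγone hb₀ p₀ Ts
    have hDj : 0 < (((F.L : ℝ) ^ j / γ) * θBal F.L γ b₀ p₀ j ^ 2) := mul_pos (div_pos (pow_pos hLpos j) hγ) (pow_pos hθj 2)
    have hDT : 0 < (((F.L : ℝ) ^ Ts / γ) * θBal F.L γ b₀ p₀ Ts ^ 2) := mul_pos (div_pos (pow_pos hLpos Ts) hγ) (pow_pos hθT 2)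
    have hx0 : 0 ≤ w / (((F.L : ℝ) ^ Ts / γ) * θBal F.L γ b₀ p₀ Ts ^ 2) := div_nonneg hw0 hDT.le
    -- STEP 2 (the tilted fibre variance is the chart ratio on the window): ✓(JVs) + the `wgt` spelling
    have hTs₀ : j₀ ≤ Ts := by omega
    have hTsT : Ts ≤ T := hTs.le
    have hposT : ∀ U, PlaqSmall (θBal F.L γ b₀ p₀ Ts) U → 0 < ρ Ts U ∧ 0 < ρ' Ts U := fun U hU => (hwin Ts hTs₀ hTsT).1 U hU
    have hcT : ContinuousOn (ρ Ts) {U | PlaqSmall (θBal F.L γ b₀ p₀ Ts) U} := (hwin Ts hTs₀ hTsT).2.2.2.2.2.2.2.1.1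
    have hcT' : ContinuousOn (ρ' Ts) {U | PlaqSmall (θBal F.L γ b₀ p₀ Ts) U} := (hwin Ts hTs₀ hTsT).2.2.2.2.2.2.2.1.2
    have hmeasT : ∀ (f : GaugeField (F.P Ts) 0 ↥(Matrix.specialUnitaryGroup (Fin 2) ℂ) → ℝ),
        (∃ κ' : ℝ, MemAtHeight F ℰp Ts (prm Ts) (fun U => Real.exp κ' * f U)) → Measurable f := by
      intro f ⟨κ', hκ'⟩
      have hm1 : Measurable (fun U => Real.exp κ' * f U) := hκ'.measurable
      have hm2 : f = fun U => (Real.exp κ')⁻¹ * (Real.exp κ' * f U) := by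
        funext U; rw [← mul_assoc, inv_mul_cancel₀ (Real.exp_pos κ').ne', one_mul]
      rw [hm2]; exact hm1.const_mul _
    have hρm : Measurable (ρ Ts) := hmeasT _ (hwin Ts hTs₀ hTsT).2.2.2.1
    have hρ'm : Measurable (ρ' Ts) := hmeasT _ (hwin Ts hTs₀ hTsT).2.2.2.2.1
    obtain ⟨hχc, hχ0, hχsupp, hχpos⟩ := hMWA j hjA Ts hjTs
    haveI : BorelSpace (GaugeField (F.P Ts) 0 ↥(Matrix.specialUnitaryGroup (Fin 2) ℂ)) :=
      Literature.MathematicalPhysics.QuantumFieldTheory.Balaban1983to89.T3OrbitAverage.instBorelSpaceGaugeField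
    haveI := hτ
    have hmap := hdis {V | PlaqSmall (θBal F.L γ b₀ p₀ j) V} (measurableSet_plaqSmall _)
    have hJV := Summit.QuantumFields.YangMills.Theorems.OrganTangentChartVarianceRepresentationSelf.tiltedVariance_eq_chartRatio_on_window_self
      F γ b₀ p₀ j Ts hjTs hθT (ρ Ts) (ρ' Ts) hρm hρ'm hposT hcT hcT' (fun U : GaugeField (F.P Ts) 0 ↥(Matrix.specialUnitaryGroup (Fin 2) ℂ) => ∏ i ∈ Finset.range (Ts - j), (if h : j + 1 + i ≤ Ts then (∏ p : Plaq (F.P (j + 1 + i)) 0, max 0 (min 1 ((24 / 25 * θBal F.L γ b₀ p₀ (j + 1 + i) - dist1 (GaugeField.plaqHol (descendTo F ℰp (j + 1 + i) Ts h U) p)) / ((24 / 25 - 1 / 2) * θBal F.L γ b₀ p₀ (j + 1 + i))))) else 1)) hχc hχ0 hχsupp hχpos σ₀ hσ₀M hbind₀ hfib₀ lam hlam hA1 hA2 hA3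
      τ Φ hΦm J hJm S hS (fun V _ z => hsec V z) hmap (fun f hf hsupp => Filter.Eventually.of_forall (hcont f hf hsupp))
      (fun _ => CJ) (integrable_const _) (fun V _ => Filter.Eventually.of_forall fun z => hJle V z) hpos
    have hvar : ∀ X : GaugeField (F.P j) 0 ↥(Matrix.specialUnitaryGroup (Fin 2) ℂ), PlaqSmall (θBal F.L γ b₀ p₀ j / 4) X → ∀ t : ℝ,
        ProbabilityTheory.variance (fun U => Real.log (ρ Ts U) - Real.log (ρ' Ts U)) (((lam X).withDensity (fun U => ENNReal.ofReal ((∏ i ∈ Finset.range (Ts - j), (if h : j + 1 + i ≤ Ts then (∏ p : Plaq (F.P (j + 1 + i)) 0, max 0 (min 1 ((24 / 25 * θBal F.L γ b₀ p₀ (j + 1 + i) - dist1 (GaugeField.plaqHol (descendTo F ℰp (j + 1 + i) Ts h U) p)) / ((24 / 25 - 1 / 2) * θBal F.L γ b₀ p₀ (j + 1 + i))))) else 1)) * ρ' Ts U))).tilted (fun U => t * (Real.log (ρ Ts U) - Real.log (ρ' Ts U)))) = (∫ z, ((Real.log (ρ Ts (Φ (X, z))) - Real.log (ρ' Ts (Φ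 (X, z)))) - ∫ z', (Real.log (ρ Ts (Φ (X, z'))) - Real.log (ρ' Ts (Φ (X, z')))) * (wgt F γ b₀ p₀ j Ts ρ ρ' τ Φ J t) X z' ∂τ) ^ 2 * (wgt F γ b₀ p₀ j Ts ρ ρ' τ Φ J t) X z ∂τ) := by
      intro X hX4 t
      have hX : PlaqSmall (θBal F.L γ b₀ p₀ j) X := fun p => (hX4 p).trans_le (by linarith [hθj.le])
      refine (hJV X hX t).trans ?_
      simp only [wgt, wNum, mwCut]
      exact ratio_eq_wgtForm τ _ _
    -- the witnesses: w′, k′_JVAR := 4kV₁ + 2kV₂ + kV₃ + 2kV₃ᵀ + kV₄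
    refine ⟨(4 * NV1 + 2 * NV2 + 3 * NV3 + NV4) * ((((F.L : ℝ) ^ j / γ) * θBal F.L γ b₀ p₀ j ^ 2) / (((F.L : ℝ) ^ Ts / γ) * θBal F.L γ b₀ p₀ Ts ^ 2)) * w * (w / (((F.L : ℝ) ^ Ts / γ) * θBal F.L γ b₀ p₀ Ts ^ 2))
        + (4 * δV1 j + 2 * δV2 j + 3 * δV3 j + δV4 j) * (((F.L : ℝ) ^ j / γ) * θBal F.L γ b₀ p₀ j ^ 2), ?_, ?_,
      fun B B' => 4 * kV₁ B B' + 2 * kV₂ B B' + kV₃ B B' + 2 * kV₃ B' B + kV₄ B B', ?_, ?_, ?_⟩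
    · -- 0 ≤ w′
      obtain ⟨a1, a2, a3, a4⟩ := hδV0 j
      have h1 : 0 ≤ 4 * NV1 + 2 * NV2 + 3 * NV3 + NV4 := by positivity
      have h2 : 0 ≤ 4 * δV1 j + 2 * δV2 j + 3 * δV3 j + δV4 j := by positivity
      exact add_nonneg (mul_nonneg (mul_nonneg (mul_nonneg h1 (div_nonneg hDj.le hDT.le)) hw0) hx0) (mul_nonneg h2 hDj.le)
    · -- the budget line: θ·(w′/D_j) ≤ C·x·x + δ j
      have key : ((4 * NV1 + 2 * NV2 + 3 * NV3 + NV4) * ((((F.L : ℝ) ^ j / γ) * θBal F.L γ b₀ p₀ j ^ 2) / (((F.L : ℝ) ^ Ts / γ) * θBal F.L γ b₀ p₀ Ts ^ 2)) * w * (w / (((F.L : ℝ) ^ Ts / γ) * θBal F.L γ b₀ p₀ Ts ^ 2))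
          + (4 * δV1 j + 2 * δV2 j + 3 * δV3 j + δV4 j) * (((F.L : ℝ) ^ j / γ) * θBal F.L γ b₀ p₀ j ^ 2)) / (((F.L : ℝ) ^ j / γ) * θBal F.L γ b₀ p₀ j ^ 2)
          = (4 * NV1 + 2 * NV2 + 3 * NV3 + NV4) * (w / (((F.L : ℝ) ^ Ts / γ) * θBal F.L γ b₀ p₀ Ts ^ 2)) * (w / (((F.L : ℝ) ^ Ts / γ) * θBal F.L γ b₀ p₀ Ts ^ 2)) + (4 * δV1 j + 2 * δV2 j + 3 * δV3 j + δV4 j) := by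
        field_simp
      rw [key, one_mul]
    · intro B B'
      have := hkV₁0 B B'; have := hkV₂0 B B'; have := hkV₃0 B B'; have := hkV₃0 B' B; have := hkV₄0 B B'
      positivity
    · -- row mass of k′_JVAR
      intro B
      have hcol : ∑ B', kV₃ B' B * Real.exp (κ * (B.src.tdist B'.src : ℝ)) ≤ (NV3 * ((((F.L : ℝ) ^ j / γ) * θBal F.L γ b₀ p₀ j ^ 2) / (((F.L : ℝ) ^ Ts / γ) * θBal F.L γ b₀ p₀ Ts ^ 2)) * w * (w / (((F.L : ℝ) ^ Ts / γ) * θBal F.L γ b₀ p₀ Ts ^ 2)) + δV3 j * (((F.L : ℝ) ^ j / γ) * θBal F.L γ b₀ p₀ j ^ 2)) := by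
        have h := hkV₃col B
        refine le_of_eq_of_le (Finset.sum_congr rfl fun B' _ => ?_) h
        rw [tdist_comm']
      have hsplit : ∑ B', (4 * kV₁ B B' + 2 * kV₂ B B' + kV₃ B B' + 2 * kV₃ B' B + kV₄ B B') * Real.exp (κ * (B.src.tdist B'.src : ℝ))
          = 4 * (∑ B', kV₁ B B' * Real.exp (κ * (B.src.tdist B'.src : ℝ))) + 2 * (∑ B', kV₂ B B' * Real.exp (κ * (B.src.tdist B'.src : ℝ)))
            + (∑ B', kV₃ B B' * Real.exp (κ * (B.src.tdist B'.src : ℝ))) + 2 * (∑ B', kV₃ B' B * Real.exp (κ * (B.src.tdist B'.src : ℝ)))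
            + (∑ B', kV₄ B B' * Real.exp (κ * (B.src.tdist B'.src : ℝ))) := by
        rw [Finset.mul_sum, Finset.mul_sum, Finset.mul_sum, ← Finset.sum_add_distrib, ← Finset.sum_add_distrib,
          ← Finset.sum_add_distrib, ← Finset.sum_add_distrib]
        exact Finset.sum_congr rfl fun B' _ => by ring
      rw [hsplit]
      calc _ ≤ 4 * (NV1 * ((((F.L : ℝ) ^ j / γ) * θBal F.L γ b₀ p₀ j ^ 2) / (((F.L : ℝ) ^ Ts / γ) * θBal F.L γ b₀ p₀ Ts ^ 2)) * w * (w / (((F.L : ℝ) ^ Ts / γ) * θBal F.L γ b₀ p₀ Ts ^ 2)) + δV1 j * (((F.L : ℝ) ^ j / γ) * θBal F.L γ b₀ p₀ j ^ 2)) + 2 * (NV2 * ((((F.L : ℝ) ^ j / γ) * θBal F.L γ b₀ p₀ j ^ 2) / (((F.L : ℝ) ^ Ts / γ) * θBal F.L γ b₀ p₀ Ts ^ 2)) * w * (w / (((F.L : ℝ) ^ Ts / γ) * θBal F.L γ b₀ p₀ Ts ^ 2)) + δV2 j * (((F.L : ℝ) ^ j / γ) * θBal F.L γ b₀ p₀ j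 ^ 2)) + (NV3 * ((((F.L : ℝ) ^ j / γ) * θBal F.L γ b₀ p₀ j ^ 2) / (((F.L : ℝ) ^ Ts / γ) * θBal F.L γ b₀ p₀ Ts ^ 2)) * w * (w / (((F.L : ℝ) ^ Ts / γ) * θBal F.L γ b₀ p₀ Ts ^ 2)) + δV3 j * (((F.L : ℝ) ^ j / γ) * θBal F.L γ b₀ p₀ j ^ 2)) + 2 * (NV3 * ((((F.L : ℝ) ^ j / γ) * θBal F.L γ b₀ p₀ j ^ 2) / (((F.L : ℝ) ^ Ts / γ) * θBal F.L γ b₀ p₀ Ts ^ 2)) * w * (w / (((F.L : ℝ) ^ Ts / γ) * θBal F.L γ b₀ p₀ Ts ^ 2)) + δV3 j * (((F.L : ℝ) ^ j / γ) * θBal F.L γ b₀ p₀ j ^ 2)) + (NV4 * ((((F.L : ℝ) ^ j / γ) * θBal F.L γ b₀ p₀ j ^ 2) / (((F.L : ℝ) ^ Ts / γ) * θBal F.L γ b₀ p₀ Ts ^ 2)) * w * (w / (((F.L : ℝ) ^ Ts / γ) * θBal F.L γ b₀ p₀ Ts ^ 2)) + δV4 j * (((F.L : ℝ) ^ j / γ)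 * θBal F.L γ b₀ p₀ j ^ 2)) :=
            add_le_add (add_le_add (add_le_add (add_le_add (mul_le_mul_of_nonneg_left (hkV₁row B) (by norm_num))
              (mul_le_mul_of_nonneg_left (hkV₂row B) (by norm_num))) (hkV₃row B)) (mul_le_mul_of_nonneg_left hcol (by norm_num))) (hkV₄row B)
        _ = _ := by ring
    · -- the square clause, every t ∈ [0,1]
      intro t ht b b' v v' U V W Y hv hv' hU hV hW hY hVU hVb hWU hWb' hYV hYb'
      obtain ⟨ht0, ht1⟩ := ht
      have hθ4 : 0 < θBal F.L γ b₀ p₀ j / 4 := by positivity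
      have hvc : ‖v‖ ≤ rc * (θBal F.L γ b₀ p₀ j / 4) := hv.trans (mul_le_mul_of_nonneg_right (half_le_self hrc.le) hθ4.le)
      have hvc' : ‖v'‖ ≤ rc * (θBal F.L γ b₀ p₀ j / 4) := hv'.trans (mul_le_mul_of_nonneg_right (half_le_self hrc.le) hθ4.le)
      -- the fourth corner's law edge
      obtain ⟨m, hm, hYW, hYbm⟩ := fourthCorner_lawEdge U V W Y b b' v v' hVU hVb hWU hWb' hYV hYb'
      have hs3 : Real.sqrt 3 ≤ 2 := by
        rw [show (2 : ℝ) = Real.sqrt 4 by rw [show (4 : ℝ) = 2 ^ 2 by norm_num, Real.sqrt_sq (by norm_num : (0:ℝ) ≤ 2)]]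
        exact Real.sqrt_le_sqrt (by norm_num)
      have hm2 : ‖m‖ ≤ 2 * ‖v‖ := hm.trans (mul_le_mul_of_nonneg_right hs3 (norm_nonneg v))
      have hmc : ‖m‖ ≤ rc * (θBal F.L γ b₀ p₀ j / 4) := by
        refine hm2.trans ?_
        rw [show rc * (θBal F.L γ b₀ p₀ j / 4) = 2 * (rc / 2 * (θBal F.L γ b₀ p₀ j / 4)) by ring]
        exact mul_le_mul_of_nonneg_left hv two_pos.le
      have hs : 0 ≤ ‖v‖ / (θBal F.L γ b₀ p₀ j / 4) := div_nonneg (norm_nonneg _) hθ4.le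
      have hs' : 0 ≤ ‖v'‖ / (θBal F.L γ b₀ p₀ j / 4) := div_nonneg (norm_nonneg _) hθ4.le
      rw [hvar Y hY t, hvar V hV t, hvar W hW t, hvar U hU t]
      -- (JV0-h): normalisation and moments
      obtain ⟨iwY, hwY1, iUY, iUY2⟩ := hJV0 t ht0 ht1 U Y hU hY
      obtain ⟨-, -, iVY, iVY2⟩ := hJV0 t ht0 ht1 V Y hV hY
      obtain ⟨-, -, iWY, iWY2⟩ := hJV0 t ht0 ht1 W Y hW hY
      obtain ⟨-, -, iYY, iYY2⟩ := hJV0 t ht0 ht1 Y Y hY hY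
      obtain ⟨iwV, -, iUV, iUV2⟩ := hJV0 t ht0 ht1 U V hU hV
      obtain ⟨-, -, iVV, iVV2⟩ := hJV0 t ht0 ht1 V V hV hV
      obtain ⟨iwW, -, iUW, iUW2⟩ := hJV0 t ht0 ht1 U W hU hW
      obtain ⟨-, -, iWW, iWW2⟩ := hJV0 t ht0 ht1 W W hW hW
      -- (JV3′) direct and transposed, (JV4′), (JV2)
      obtain ⟨-, -, hC⟩ := hJV3 t ht0 ht1 b b' v v' U V V Y hvc hvc' hU hV hV hY hVU hVb hYV hYb' _ _ _ _ rfl rfl rfl rfl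
      obtain ⟨-, -, hC'⟩ := hJV3 t ht0 ht1 b' b v' m U W W Y hvc' hmc hU hW hW hY hWU hWb' hYW hYbm _ _ _ _ rfl rfl rfl rfl
      obtain ⟨-, -, -, -, hD⟩ := hJV4 t ht0 ht1 b b' v v' U V W Y hvc hvc' hU hV hW hY hVU hVb hWU hWb' hYV hYb' _ _ _ _ rfl rfl rfl rfl
      have hB := hJV2 t ht0 ht1 b b' v v' U V W Y Y hvc hvc' hU hV hW hY hY hVU hVb hWU hWb' hYV hYb' _ _ rfl rfl
      have hA : ∀ g : Z → ℝ, (g = (fun z => (Real.log (ρ Ts (Φ (U, z))) - Real.log (ρ' Ts (Φ (U, z))))) ∨ g = (fun z => (Real.log (ρ Ts (Φ (V, z))) - Real.log (ρ' Ts (Φ (V, z))))) ∨ g = (fun z => (Real.log (ρ Ts (Φ (W, z))) - Real.log (ρ' Ts (Φ (W, z))))) ∨ g = (fun z => (Real.log (ρ Ts (Φ (Y, z))) - Real.log (ρ' Ts (Φ (Y, z)))))) →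
          Integrable (fun z => ((Real.log (ρ Ts (Φ (Y, z))) - Real.log (ρ' Ts (Φ (Y, z)))) - (Real.log (ρ Ts (Φ (V, z))) - Real.log (ρ' Ts (Φ (V, z)))) - (Real.log (ρ Ts (Φ (W, z))) - Real.log (ρ' Ts (Φ (W, z)))) + (Real.log (ρ Ts (Φ (U, z))) - Real.log (ρ' Ts (Φ (U, z))))) * (g z - ∫ z', g z' * (wgt F γ b₀ p₀ j Ts ρ ρ' τ Φ J t) Y z' ∂τ) * (wgt F γ b₀ p₀ j Ts ρ ρ' τ Φ J t) Y z) τ ∧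
          |∫ z, ((Real.log (ρ Ts (Φ (Y, z))) - Real.log (ρ' Ts (Φ (Y, z)))) - (Real.log (ρ Ts (Φ (V, z))) - Real.log (ρ' Ts (Φ (V, z)))) - (Real.log (ρ Ts (Φ (W, z))) - Real.log (ρ' Ts (Φ (W, z)))) + (Real.log (ρ Ts (Φ (U, z))) - Real.log (ρ' Ts (Φ (U, z))))) * (g z - ∫ z', g z' * (wgt F γ b₀ p₀ j Ts ρ ρ' τ Φ J t) Y z' ∂τ) * (wgt F γ b₀ p₀ j Ts ρ ρ' τ Φ J t) Y z ∂τ|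
            ≤ kV₁ b b' * (‖v‖ / (θBal F.L γ b₀ p₀ j / 4)) * (‖v'‖ / (θBal F.L γ b₀ p₀ j / 4)) := by
        rintro g (rfl | rfl | rfl | rfl)
        · exact hJV1 t ht0 ht1 b b' v v' U V W Y U Y hvc hvc' hU hV hW hY hU hY hVU hVb hWU hWb' hYV hYb' _ rfl
        · exact hJV1 t ht0 ht1 b b' v v' U V W Y V Y hvc hvc' hU hV hW hY hV hY hVU hVb hWU hWb' hYV hYb' _ rfl
        · exact hJV1 t ht0 ht1 b b' v v' U V W Y W Y hvc hvc' hU hV hW hY hW hY hVU hVb hWU hWb' hYV hYb' _ rfl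
        · exact hJV1 t ht0 ht1 b b' v v' U V W Y Y Y hvc hvc' hU hV hW hY hY hY hVU hVb hWU hWb' hYV hYb' _ rfl
      have hmain := Summit.QuantumFields.YangMills.Theorems.FluctuationComparisonRegPrIntLOrganTangentFibreVarianceRebracket.abs_fibreVar_secondDiff_le_means τ (fun z => (Real.log (ρ Ts (Φ (U, z))) - Real.log (ρ' Ts (Φ (U, z))))) (fun z => (Real.log (ρ Ts (Φ (V, z))) - Real.log (ρ' Ts (Φ (V, z))))) (fun z => (Real.log (ρ Ts (Φ (W, z))) - Real.log (ρ' Ts (Φ (W, z))))) (fun z => (Real.log (ρ Ts (Φ (Y, z))) - Real.log (ρ' Ts (Φ (Y, z)))))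
        (fun z => (wgt F γ b₀ p₀ j Ts ρ ρ' τ Φ J t) U z) (fun z => (wgt F γ b₀ p₀ j Ts ρ ρ' τ Φ J t) V z) (fun z => (wgt F γ b₀ p₀ j Ts ρ ρ' τ Φ J t) W z) (fun z => (wgt F γ b₀ p₀ j Ts ρ ρ' τ Φ J t) Y z)
        (kV₁ b b' * (‖v‖ / (θBal F.L γ b₀ p₀ j / 4)) * (‖v'‖ / (θBal F.L γ b₀ p₀ j / 4))) (kV₂ b b' * (‖v‖ / (θBal F.L γ b₀ p₀ j / 4)) * (‖v'‖ / (θBal F.L γ b₀ p₀ j / 4)))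
        (kV₃ b b' * (‖v‖ / (θBal F.L γ b₀ p₀ j / 4)) * (‖v'‖ / (θBal F.L γ b₀ p₀ j / 4))) (kV₃ b' b * (‖v'‖ / (θBal F.L γ b₀ p₀ j / 4)) * (‖m‖ / (θBal F.L γ b₀ p₀ j / 4)))
        (kV₄ b b' * (‖v‖ / (θBal F.L γ b₀ p₀ j / 4)) * (‖v'‖ / (θBal F.L γ b₀ p₀ j / 4)))
        iwY hwY1 iUY iUY2 iVY iVY2 iWY iWY2 iYY iYY2 iwV iUV iUV2 iVV iVV2 iwW iUW iUW2 iWW iWW2 hA hB hC hC' hD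
      refine hmain.trans ?_
      have hI2' : kV₃ b' b * (‖v'‖ / (θBal F.L γ b₀ p₀ j / 4)) * (‖m‖ / (θBal F.L γ b₀ p₀ j / 4)) ≤ 2 * kV₃ b' b * (‖v‖ / (θBal F.L γ b₀ p₀ j / 4)) * (‖v'‖ / (θBal F.L γ b₀ p₀ j / 4)) := by
        have hmv : ‖m‖ / (θBal F.L γ b₀ p₀ j / 4) ≤ 2 * (‖v‖ / (θBal F.L γ b₀ p₀ j / 4)) := by
          rw [← mul_div_assoc]; exact div_le_div_of_nonneg_right hm2 hθ4.le
        have hk := hkV₃0 b' b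
        calc kV₃ b' b * (‖v'‖ / (θBal F.L γ b₀ p₀ j / 4)) * (‖m‖ / (θBal F.L γ b₀ p₀ j / 4))
            ≤ kV₃ b' b * (‖v'‖ / (θBal F.L γ b₀ p₀ j / 4)) * (2 * (‖v‖ / (θBal F.L γ b₀ p₀ j / 4))) :=
              mul_le_mul_of_nonneg_left hmv (mul_nonneg hk hs')
          _ = 2 * kV₃ b' b * (‖v‖ / (θBal F.L γ b₀ p₀ j / 4)) * (‖v'‖ / (θBal F.L γ b₀ p₀ j / 4)) := by ring
      refine (add_le_add (add_le_add le_rfl hI2') le_rfl).trans (le_of_eq ?_)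
      ring

end Summit.QuantumFields.YangMills.Theorems.OrganTangentJvarHOfSpreadFibreLawJ

end
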